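import Summits.ValiantsHypothesis.ValiantsHypothesis.Theorems.DivisionGapDefs
import Summits.ValiantsHypothesis.ValiantsHypothesis.Theorems.DivisionGapPerMultiplesHardStubColConcentration
import Literature.Computability.AlgebraicComplexity.ArithCircuitProofs

/-!
# Crux `DivisionGap.PerDivisionHard` (stmt-ValiantsHypothesis-5065), line
`pair-descent-jss-endpoint` (v13.1) — stub `stub_transposePair`: transposition is free for the pair

The v13 rung of the line bounds the monotone pair `(per_n · h, h)` over `ℝ≥0` for cofactors `h`
with few `A`-COLUMN contents on a balanced ROW set `A`; its twin for COLUMN sets (few `B`-row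
contents) is obtained by transposing the variable matrix, `hᵀ := rename Prod.swap h`
(`x_(r,c) ↦ x_(c,r)`).  This file supplies the three facts that derivation uses:

* `L(per_n · hᵀ) ≤ L(per_n · h)`: `rename` is a ring homomorphism (`map_mul`) fixing the generic
  permanent (`ColConcentration.rename_swap_perPoly`: `per(Xᵀ) = per(X)`,
  `Matrix.permanent_transpose`), so `per_n · hᵀ = rename Prod.swap (per_n · h)`, and renaming
  along the injective `Prod.swap` preserves the tree's monotone fan-in-two `complexity`
  (`ColConcentration.complexity_perPoly_mul_rename_swap`, landed for the sister crux
  `PerMultiplesHard`, line `uncharged-face-walk`);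
* `L(hᵀ) ≤ L(h)`: renaming along ANY map of the variables never increases `complexity`
  (`complexity_rename_le_holds'`);
* the monomials of `hᵀ` are the transposes of the monomials of `h`
  (`MvPolynomial.support_rename_of_injective`, `Prod.swap` is injective).  [folklore]
-/

noncomputable section

-- `Summit.ValiantsHypothesis.ValiantsHypothesis.…` is the tree's mandated single-conjunct layout
-- (Sub = Summit), so the duplicated namespace component is intended.
set_option linter.dupNamespace false

namespace Summit.ValiantsHypothesis.ValiantsHypothesis.Theorems.DivisionGapPerDivisionHard

open MvPolynomial Literature.Computability.AlgebraicComplexity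
open Summit.ValiantsHypothesis.ValiantsHypothesis.Theorems.DivisionGap.PerMultiplesHard.ColConcentration
  (complexity_perPoly_mul_rename_swap)
open scoped NNReal

/-- **Transposition is free for the pair** (stub `stub_transposePair` of line
`pair-descent-jss-endpoint`, v13.1).  Renaming the variables along `Prod.swap`
(`x_(r,c) ↦ x_(c,r)`) fixes `per_n` and never increases monotone complexity
(`complexity_rename_le_holds'`, any map), so `L(per_n · hᵀ) ≤ L(per_n · h)` (`rename` is a ring
map: `map_mul`; `complexity_perPoly_mul_rename_swap`) and `L(hᵀ) ≤ L(h)`; and the monomials of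
`hᵀ` are the transposes of those of `h` (`MvPolynomial.support_rename_of_injective`). [folklore] -/
theorem stub_transposePair :
    ∀ (n : ℕ) (h : MvPolynomial (Fin n × Fin n) ℝ≥0),
      complexity (perPoly (Fin n) ℝ≥0 * rename (Prod.swap : Fin n × Fin n → Fin n × Fin n) h) ≤
          complexity (perPoly (Fin n) ℝ≥0 * h) ∧
        complexity (rename (Prod.swap : Fin n × Fin n → Fin n × Fin n) h) ≤ complexity h ∧
        (rename (Prod.swap : Fin n × Fin n → Fin n × Fin n) h).support =
          h.support.image (Finsupp.mapDomain Prod.swap) :=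
  fun _ h => ⟨(complexity_perPoly_mul_rename_swap h).le, complexity_rename_le_holds' Prod.swap h,
    support_rename_of_injective Prod.swap_injective⟩

end Summit.ValiantsHypothesis.ValiantsHypothesis.Theorems.DivisionGapPerDivisionHard
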